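import Summits.QuantumFields.YangMills.Theorems.BalabanUVNodesN19TVTiltSharp

/-!
# BalabanUVNodes ∕ N19 — THE SHARP TOTAL-VARIATION ⇒ TILTED-MEAN CONSTANT (II: the extremal witness, the class-level faces, the odds structure)

Cell `pub-ymgap` (HUMAN RULING D-0062 Track A; D-0149 width seats), node N19 = NE7 (→ N14's binder), WIDTH SEAT `pub-ymgap-dag-n19-w2` (g3; bus
CLAIM-1 ∕ INTENT-1 INBOX l.27645, file 1b of the 400-line split).  Filed `--kind proof --supports` K3⁷ `SpineGivenEndpointR13SepCoPH` =
stmt-QuantumFields-20544 `--as helper`.  COUNT-NEUTRAL.  THEOREMS ONLY (0 `def`); imports file 1a `…N19TVTiltSharp` (hence n19-c's `…N19CoreTVInvariant`);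
edits nothing, re-declares nothing.

WHAT IS PROVED ([folklore]-grade; the witness and the sharp class-level rate are the content).
* §4 ★★ SHARPNESS `tv_tilt_sharp_toy`: on `Bool`, run A's law `ν₁ = δ_false`, run B's `ν₂ = (1 − ρ)·δ_false + ρ·δ_true` (`0 ≤ ρ ≤ 1`), the observable
  `F false = −B`, `F true = B` (`B ≥ 0`), a tilt `s ≥ 0`: `ν₂` is a probability law, the two laws are `ρ`-close on every set, and the tilted-mean gap
  EQUALS `2B·e^{2sB}ρ ∕ (1 + (e^{2sB} − 1)ρ)` — file 1a's `abs_tiltedMean_sub_tiltedMean_le_of_tv_sharp` bound at `|s| = s`.  So no constant below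
  file 1a's is a theorem, at any `(B, s, ρ)`; in particular the slope `2B·e^{2|s|B}` at `ρ → 0` is optimal (the tree's was `4B·e^{2|s|B}`).
* §5 class level, n19-c's `…N19CoreTVInvariant.tiltedMeanMatching_of_tv` binder prefix VERBATIM: ★ `tiltedMeanMatching_of_tv_sharp` (TV_cl(`ρ`) ⇒
  `TiltedMeanMatching l₀ T Bad W μA W μB (K ↦ 2B·e^{2l₀B}ρ_K ∕ (1 + (e^{2l₀B} − 1)ρ_K))`, classes massless in one run included — they force `ρ_K ≥ 1`,
  where the rate is `≥ 2B`) · `tiltedMeanMatching_of_tv_half` (`K ↦ 2B·e^{2l₀B}·ρ_K` — HALF the tree's; summable iff `Σρ_K < ∞`, as before).  These are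
  drop-in sharpenings for the consumers of the TV face (this seat's g0 `…N19ShapeFaceN14AtRecordTV`, n19-c `…N19TiltPathRoad.tiltedMeanMatching_of_tiltPath`,
  the n14 lanes' `…N14BinderAtSpineReadingOfRecord13CoPH(V)`), none of which is edited here.
* §6 structure: `sharpTiltRate_odds` (`g∕(1 − g) = κ·ρ∕(1 − ρ)`: a bounded tilt multiplies the ODDS of set-closeness by `κ`) · `sharpTiltRate_comp`
  (`g(κ₂, g(κ₁, ρ)) = g(κ₁κ₂, ρ)`: successive tilts compose exactly — iterating file 1a's §2 loses nothing).

HONEST FRAMING.  Elementary; hypothesis shapes only (TV_cl is produced by nobody); ZERO Bałaban content; discharges nothing; NE7 ∕ NE1′ NOT PRINTED as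
two-run statements for d = 4 and NOT proved; N14 ∕ N19 NOT discharged; K3⁷ OPEN, not claimed; counts UNMOVED (typed 28∕28 · discharged 5∕27 · A 5∕28);
no count claim.  One finite four-torus programme at fixed `ε`; R4 closes the conditional finite-𝕋⁴ rung `BalabanLadder.UV` only — NOT ℝ⁴, NOT OS, NOT the
Yang–Mills mass gap, NOT Clay.  0 `def`; 0 `sorry`; standard axioms.
-/

set_option autoImplicit false

noncomputable section

open MeasureTheory ProbabilityTheory
open scoped ENNReal

namespace Summit.QuantumFields.YangMills.BalabanUVNodes.N19TVTiltSharpLeaf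

open Summit.QuantumFields.BalabanUV.T4Continuum.NE1p.DressedMGFForm (tiltedMean TiltedMeanMatching)
open Summit.QuantumFields.BalabanUV.T4Continuum.NE1p.TiltedMeanInfluence (abs_tiltedMean_le)
open Summit.QuantumFields.YangMills.BalabanUVNodes.N19TVTiltSharp

/-! ## §4 Sharpness: the two-point pair attains file 1a's §3 constant [folklore] -/

section Sharpness

/-- ★★ **FILE 1a's §3 CONSTANT IS OPTIMAL.**  On `Bool`: run A's law `ν₁ = δ_false`, run B's `ν₂ = (1 − ρ)·δ_false + ρ·δ_true` (`0 ≤ ρ ≤ 1`: run B moves mass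
`ρ` to a point run A does not charge), the observable `F false = −B`, `F true = B` (`B ≥ 0`), a tilt `s ≥ 0`.  Then (i) `ν₂` is a probability law,
(ii) the two laws are `ρ`-close on every set, and (iii) the tilted-mean gap EQUALS `2B·e^{2sB}ρ ∕ (1 + (e^{2sB} − 1)ρ)` — the bound of
`N19TVTiltSharp.abs_tiltedMean_sub_tiltedMean_le_of_tv_sharp` at `|s| = s`.  So no smaller constant is a theorem, for any `(B, s, ρ)`. [folklore] -/
theorem tv_tilt_sharp_toy {B ρ s : ℝ} (hB : 0 ≤ B) (hρ : 0 ≤ ρ) (hρ1 : ρ ≤ 1) (hs : 0 ≤ s) :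
    let ν₁ : Measure Bool := Measure.dirac false
    let ν₂ : Measure Bool := ENNReal.ofReal (1 - ρ) • Measure.dirac false + ENNReal.ofReal ρ • Measure.dirac true
    let F : Bool → ℝ := fun x => cond x B (-B)
    IsProbabilityMeasure ν₂ ∧ (∀ S : Set Bool, |ν₂.real S - ν₁.real S| ≤ ρ) ∧
      tiltedMean F ν₂ s - tiltedMean F ν₁ s = 2 * B * (Real.exp (2 * (s * B)) * ρ / (1 + (Real.exp (2 * (s * B)) - 1) * ρ)) := by
  intro ν₁ ν₂ F
  have h1ρ : 0 ≤ 1 - ρ := sub_nonneg.2 hρ1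
  -- point masses
  have hν₂S : ∀ S : Set Bool, ν₂ S = ENNReal.ofReal (1 - ρ) * S.indicator 1 false + ENNReal.ofReal ρ * S.indicator 1 true := fun S => by
    show (ENNReal.ofReal (1 - ρ) • Measure.dirac false + ENNReal.ofReal ρ • Measure.dirac true) S = _
    rw [Measure.add_apply, Measure.smul_apply, Measure.smul_apply, smul_eq_mul, smul_eq_mul, Measure.dirac_apply, Measure.dirac_apply]
  have hν₁S : ∀ S : Set Bool, ν₁ S = S.indicator 1 false := fun S => by
    show (Measure.dirac false : Measure Bool) S = _; rw [Measure.dirac_apply]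
  have hν₂r : ∀ S : Set Bool, ν₂.real S = (1 - ρ) * (S.indicator 1 false : ℝ≥0∞).toReal + ρ * (S.indicator 1 true : ℝ≥0∞).toReal :=
    fun S => by
      rw [measureReal_def, hν₂S, ENNReal.toReal_add (ENNReal.mul_ne_top ENNReal.ofReal_ne_top (by by_cases h : false ∈ S <;> simp [h]))
        (ENNReal.mul_ne_top ENNReal.ofReal_ne_top (by by_cases h : true ∈ S <;> simp [h])), ENNReal.toReal_mul, ENNReal.toReal_mul,
        ENNReal.toReal_ofReal h1ρ, ENNReal.toReal_ofReal hρ]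
  have hν₁r : ∀ S : Set Bool, ν₁.real S = (S.indicator 1 false : ℝ≥0∞).toReal := fun S => by rw [measureReal_def, hν₁S]
  have hprob : IsProbabilityMeasure ν₂ := ⟨by rw [hν₂S]; simp [← ENNReal.ofReal_add h1ρ hρ]⟩
  refine ⟨hprob, fun S => ?_, ?_⟩
  · rw [hν₂r, hν₁r]
    by_cases hf : false ∈ S <;> by_cases ht : true ∈ S
    · simp only [Set.indicator_of_mem hf, Set.indicator_of_mem ht, Pi.one_apply, ENNReal.toReal_one]
      rw [show (1 - ρ) * 1 + ρ * 1 - 1 = 0 by ring, abs_zero]; exact hρ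
    · simp only [Set.indicator_of_mem hf, Set.indicator_of_notMem ht, Pi.one_apply, ENNReal.toReal_one, ENNReal.toReal_zero]
      rw [show (1 - ρ) * 1 + ρ * 0 - 1 = -ρ by ring, abs_neg, abs_of_nonneg hρ]
    · simp only [Set.indicator_of_notMem hf, Set.indicator_of_mem ht, Pi.one_apply, ENNReal.toReal_one, ENNReal.toReal_zero]
      rw [show (1 - ρ) * 0 + ρ * 1 - 0 = ρ by ring, abs_of_nonneg hρ]
    · simp only [Set.indicator_of_notMem hf, Set.indicator_of_notMem ht, ENNReal.toReal_zero]
      rw [show (1 - ρ) * 0 + ρ * 0 - 0 = 0 by ring, abs_zero]; exact hρ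
  · -- the two tilted means
    haveI := hprob
    have hFm : Measurable F := measurable_of_countable F
    have hint : ∀ (ν : Measure Bool) [IsFiniteMeasure ν] (g : Bool → ℝ), Integrable g ν := fun ν _ g => Integrable.of_finite
    have htm : ∀ (ν : Measure Bool) [IsFiniteMeasure ν], tiltedMean F ν s =
        (ν.real {true} * (B * Real.exp (s * B)) + ν.real {false} * (-B * Real.exp (s * -B))) /
          (ν.real {true} * Real.exp (s * B) + ν.real {false} * Real.exp (s * -B)) := fun ν _ => by
      rw [Summit.QuantumFields.BalabanUV.T4Continuum.NE1p.TiltedMeanInfluence.tiltedMean_eq_div, integral_fintype (hint ν _),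
        integral_fintype (hint ν _), Fintype.sum_bool, Fintype.sum_bool]
      simp only [smul_eq_mul, F, cond_true, cond_false]
    have h1t : ν₁.real {true} = 0 := by rw [hν₁r]; simp
    have h1f : ν₁.real {false} = 1 := by rw [hν₁r]; simp
    have h2t : ν₂.real {true} = ρ := by rw [hν₂r]; simp
    have h2f : ν₂.real {false} = 1 - ρ := by rw [hν₂r]; simp
    rw [htm ν₂, htm ν₁, h1t, h1f, h2t, h2f]
    set E : ℝ := Real.exp (s * B) with hEdef
    set E' : ℝ := Real.exp (s * -B) with hE'def
    have hep : 0 < E := Real.exp_pos _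
    have hem : 0 < E' := Real.exp_pos _
    have hprod : E * E' = 1 := by rw [hEdef, hE'def, ← Real.exp_add, mul_neg, add_neg_cancel, Real.exp_zero]
    have hsq : E * E = Real.exp (2 * (s * B)) := by rw [hEdef, ← Real.exp_add]; ring_nf
    have hden : 0 < ρ * E + (1 - ρ) * E' := by
      rcases hρ.eq_or_lt with h0 | h0
      · rw [← h0]; simpa using hem
      · nlinarith [mul_nonneg h1ρ hem.le]
    have hden' : 0 < 1 + (Real.exp (2 * (s * B)) - 1) * ρ := by
      nlinarith [mul_nonneg (sub_nonneg.2 (Real.one_le_exp (by positivity : 0 ≤ 2 * (s * B)))) hρ]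
    -- run A's tilted mean is `−B`
    have hA : (0 * (B * E) + 1 * (-B * E')) / (0 * E + 1 * E') = -B := by
      rw [zero_mul, zero_mul, zero_add, zero_add, one_mul, one_mul, neg_mul, neg_div, mul_div_cancel_right₀ _ hem.ne']
    -- the sharp rate in the `E, E′` letters
    have hC : Real.exp (2 * (s * B)) * ρ / (1 + (Real.exp (2 * (s * B)) - 1) * ρ) = ρ * E / (ρ * E + (1 - ρ) * E') := by
      rw [div_eq_div_iff hden'.ne' hden.ne']
      linear_combination (-(ρ * (1 - ρ) * E')) * hsq + (ρ * (1 - ρ) * E) * hprod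
    rw [hA, sub_neg_eq_add, div_add' _ _ _ hden.ne', hC, mul_div_assoc', div_eq_div_iff hden.ne' hden.ne']
    ring

end Sharpness

/-! ## §5 Class level: TV_cl ⇒ `TiltedMeanMatching` at the sharp rate (n19-c's binder prefix verbatim) [folklore] -/

section Leaf

variable {ι : Type*} [DecidableEq ι] {Ω : ℕ → Type*} [∀ K, MeasurableSpace (Ω K)]
variable {l₀ B : ℝ} {T : ℕ → Finset ι} {Bad : ℕ → ℝ → Finset ι} {W : ∀ K, Ω K → ℝ}
  {μA μB : ∀ K, ι → Measure (Ω K)} {ρ : ℕ → ℝ}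

/-- ★ **(I) FROM TV_cl AT THE SHARP RATE.**  Finite class pieces of the two runs on COMMON class spaces, TV_cl(`ρ`) of the normalised class laws,
`|W| ≤ B` measurable ⇒ `TiltedMeanMatching l₀ T Bad W μA W μB (K ↦ 2B·κρ_K ∕ (1 + (κ − 1)ρ_K))`, `κ = e^{2l₀B}` — n19-c's `tiltedMeanMatching_of_tv`
with the constant replaced by the optimal one.  Per class: if `ρ_K ≥ 1` the rate is `≥ 2B ≥` the gap outright (`one_le_sharpTiltRate`, tilted means are
`≤ B`); if `ρ_K < 1` no class is massless in exactly one run (`univ` would give `ρ_K ≥ 1`), so normalise (n14-c `tiltedMean_smul_measure`) and apply file 1a's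
`abs_tiltedMean_sub_tiltedMean_le_of_tv_sharp` at `κ_s = e^{2|s|B} ≤ κ` (`sharpTiltRate_mono_kappa`). [folklore] -/
theorem tiltedMeanMatching_of_tv_sharp (hfinA : ∀ K, ∀ τ ∈ T K, IsFiniteMeasure (μA K τ))
    (hfinB : ∀ K, ∀ τ ∈ T K, IsFiniteMeasure (μB K τ)) (hB : 0 ≤ B) (hWm : ∀ K, Measurable (W K))
    (hWb : ∀ K ω, |W K ω| ≤ B)
    (hTV : ∀ (K : ℕ) (t : ℝ), |t| ≤ l₀ → ∀ τ ∈ T K \ Bad K t, ∀ S : Set (Ω K), MeasurableSet S →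
      |(μB K τ).real S / (μB K τ).real Set.univ - (μA K τ).real S / (μA K τ).real Set.univ| ≤ ρ K) :
    TiltedMeanMatching l₀ T Bad W μA W μB fun K =>
      2 * B * (Real.exp (2 * (l₀ * B)) * ρ K / (1 + (Real.exp (2 * (l₀ * B)) - 1) * ρ K)) := by
  intro K t ht τ hτ s hs
  have hτT : τ ∈ T K := (Finset.mem_sdiff.mp hτ).1
  haveI := hfinA K τ hτT; haveI := hfinB K τ hτT
  have hTV' := hTV K t ht τ hτ
  have hρ : 0 ≤ ρ K := (abs_nonneg _).trans (hTV' ∅ MeasurableSet.empty)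
  have hl₀ : 0 ≤ l₀ := (abs_nonneg s).trans hs
  have hκ₀ : 1 ≤ Real.exp (2 * (l₀ * B)) := Real.one_le_exp (by positivity)
  have hκs : 1 ≤ Real.exp (2 * (|s| * B)) := Real.one_le_exp (by positivity)
  have hκle : Real.exp (2 * (|s| * B)) ≤ Real.exp (2 * (l₀ * B)) := Real.exp_le_exp.2 (by nlinarith [abs_nonneg s])
  set g : ℝ := Real.exp (2 * (l₀ * B)) * ρ K / (1 + (Real.exp (2 * (l₀ * B)) - 1) * ρ K) with hg
  -- tilted means are bounded by `B`, and vanish on the zero measure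
  have htmB : ∀ (ν : Measure (Ω K)), |tiltedMean (W K) ν s| ≤ B := fun ν => abs_tiltedMean_le (hWb K) hB s
  have htm0 : tiltedMean (W K) (0 : Measure (Ω K)) s = 0 := by simp [tiltedMean]
  have huniv := hTV' Set.univ MeasurableSet.univ
  rcases le_or_gt 1 (ρ K) with hρ1 | hρ1
  · -- `ρ_K ≥ 1`: the rate dominates the trivial bound `2B`
    have hg1 : 1 ≤ g := one_le_sharpTiltRate hκ₀ hρ1
    calc |tiltedMean (W K) (μB K τ) s - tiltedMean (W K) (μA K τ) s|
        ≤ |tiltedMean (W K) (μB K τ) s| + |tiltedMean (W K) (μA K τ) s| := abs_sub _ _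
      _ ≤ B + B := add_le_add (htmB _) (htmB _)
      _ = 2 * B * 1 := by ring
      _ ≤ 2 * B * g := mul_le_mul_of_nonneg_left hg1 (by positivity)
  · -- `ρ_K < 1`: both pieces massive or both massless
    rcases (measureReal_nonneg : 0 ≤ (μA K τ).real Set.univ).eq_or_lt with hmA0 | hmApos
    · have hA0 : μA K τ = 0 :=
        Measure.measure_univ_eq_zero.1 ((measureReal_eq_zero_iff (measure_ne_top _ _)).1 hmA0.symm)
      rcases (measureReal_nonneg : 0 ≤ (μB K τ).real Set.univ).eq_or_lt with hmB0 | hmBpos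
      · have hB0 : μB K τ = 0 :=
          Measure.measure_univ_eq_zero.1 ((measureReal_eq_zero_iff (measure_ne_top _ _)).1 hmB0.symm)
        rw [hA0, hB0, htm0, sub_self, abs_zero]
        exact mul_nonneg (by positivity) (sharpTiltRate_nonneg hκ₀ hρ)
      · -- massless in run A only: `ρ_K ≥ 1`, excluded
        exfalso
        rw [← hmA0, div_self hmBpos.ne'] at huniv
        simp only [div_zero, sub_zero, abs_one] at huniv
        exact absurd huniv (not_le.2 hρ1)
    · rcases (measureReal_nonneg : 0 ≤ (μB K τ).real Set.univ).eq_or_lt with hmB0 | hmBpos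
      · exfalso
        rw [← hmB0, div_self hmApos.ne'] at huniv
        simp only [div_zero, zero_sub, abs_neg, abs_one] at huniv
        exact absurd huniv (not_le.2 hρ1)
      · -- both pieces massive: normalise and apply §3
        have hA0 : μA K τ Set.univ ≠ 0 := (measureReal_ne_zero_iff (measure_ne_top _ _)).1 hmApos.ne'
        have hB0 : μB K τ Set.univ ≠ 0 := (measureReal_ne_zero_iff (measure_ne_top _ _)).1 hmBpos.ne'
        set ν₁ : Measure (Ω K) := (μA K τ Set.univ)⁻¹ • μA K τ with hν₁
        set ν₂ : Measure (Ω K) := (μB K τ Set.univ)⁻¹ • μB K τ with hν₂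
        haveI : IsProbabilityMeasure ν₁ :=
          ⟨by rw [hν₁, Measure.smul_apply, smul_eq_mul, ENNReal.inv_mul_cancel hA0 (measure_ne_top _ _)]⟩
        haveI : IsProbabilityMeasure ν₂ :=
          ⟨by rw [hν₂, Measure.smul_apply, smul_eq_mul, ENNReal.inv_mul_cancel hB0 (measure_ne_top _ _)]⟩
        have hν₁S : ∀ S, ν₁.real S = (μA K τ).real S / (μA K τ).real Set.univ := fun S => by
          rw [hν₁, measureReal_ennreal_smul_apply, ENNReal.toReal_inv, ← measureReal_def, div_eq_inv_mul]
        have hν₂S : ∀ S, ν₂.real S = (μB K τ).real S / (μB K τ).real Set.univ := fun S => by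
          rw [hν₂, measureReal_ennreal_smul_apply, ENNReal.toReal_inv, ← measureReal_def, div_eq_inv_mul]
        have hTVν : ∀ S, MeasurableSet S → |ν₂.real S - ν₁.real S| ≤ ρ K := fun S hS => by
          rw [hν₁S, hν₂S]; exact hTV' S hS
        have h1 : tiltedMean (W K) ν₁ s = tiltedMean (W K) (μA K τ) s :=
          YMDAG.N14.ConvexFibreMatching.tiltedMean_smul_measure _ _ (ENNReal.inv_ne_zero.2 (measure_ne_top _ _))
            (ENNReal.inv_ne_top.2 hA0) s
        have h2 : tiltedMean (W K) ν₂ s = tiltedMean (W K) (μB K τ) s :=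
          YMDAG.N14.ConvexFibreMatching.tiltedMean_smul_measure _ _ (ENNReal.inv_ne_zero.2 (measure_ne_top _ _))
            (ENNReal.inv_ne_top.2 hB0) s
        rw [← h1, ← h2]
        calc |tiltedMean (W K) ν₂ s - tiltedMean (W K) ν₁ s|
            ≤ 2 * B * (Real.exp (2 * (|s| * B)) * ρ K / (1 + (Real.exp (2 * (|s| * B)) - 1) * ρ K)) :=
              abs_tiltedMean_sub_tiltedMean_le_of_tv_sharp (hWm K) (hWb K) hTVν s
          _ ≤ 2 * B * g := mul_le_mul_of_nonneg_left (sharpTiltRate_mono_kappa hκs hκle hρ hρ1.le) (by positivity)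

/-- **… AT THE LINEAR RATE `2B·e^{2l₀B}·ρ_K`** — HALF n19-c's `tiltedMeanMatching_of_tv` (`sharpTiltRate_le_linear`); summable iff `Σρ_K < ∞`, as
before. [folklore] -/
theorem tiltedMeanMatching_of_tv_half (hfinA : ∀ K, ∀ τ ∈ T K, IsFiniteMeasure (μA K τ))
    (hfinB : ∀ K, ∀ τ ∈ T K, IsFiniteMeasure (μB K τ)) (hB : 0 ≤ B) (hWm : ∀ K, Measurable (W K))
    (hWb : ∀ K ω, |W K ω| ≤ B)
    (hTV : ∀ (K : ℕ) (t : ℝ), |t| ≤ l₀ → ∀ τ ∈ T K \ Bad K t, ∀ S : Set (Ω K), MeasurableSet S →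
      |(μB K τ).real S / (μB K τ).real Set.univ - (μA K τ).real S / (μA K τ).real Set.univ| ≤ ρ K) :
    TiltedMeanMatching l₀ T Bad W μA W μB fun K => 2 * B * Real.exp (2 * (l₀ * B)) * ρ K := by
  intro K t ht τ hτ s hs
  have hρ : 0 ≤ ρ K := (abs_nonneg _).trans (hTV K t ht τ hτ ∅ MeasurableSet.empty)
  have hl₀ : 0 ≤ l₀ := (abs_nonneg s).trans hs
  have hκ₀ : 1 ≤ Real.exp (2 * (l₀ * B)) := Real.one_le_exp (by positivity)
  calc |tiltedMean (W K) (μB K τ) s - tiltedMean (W K) (μA K τ) s|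
      ≤ 2 * B * (Real.exp (2 * (l₀ * B)) * ρ K / (1 + (Real.exp (2 * (l₀ * B)) - 1) * ρ K)) :=
        tiltedMeanMatching_of_tv_sharp hfinA hfinB hB hWm hWb hTV K t ht τ hτ s hs
    _ ≤ 2 * B * (Real.exp (2 * (l₀ * B)) * ρ K) := mul_le_mul_of_nonneg_left (sharpTiltRate_le_linear hκ₀ hρ) (by positivity)
    _ = 2 * B * Real.exp (2 * (l₀ * B)) * ρ K := by ring

end Leaf

/-! ## §6 Structure of the sharp rate: tilts COMPOSE exactly (odds multiply by `κ`) [folklore] -/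

section Structure

/-- **ODDS FORM.**  For `ρ < 1` the sharp rate `g = κρ ∕ (1 + (κ − 1)ρ)` is «multiply the odds by `κ`»: `g ∕ (1 − g) = κ · (ρ ∕ (1 − ρ))` — an
`e^{±c}`-bounded tilt degrades set-closeness by the factor `κ = e^{2c}` ON THE ODDS SCALE, which is why the bound stays `≤ 1` and is attained. [folklore] -/
theorem sharpTiltRate_odds {κ ρ : ℝ} (hκ : 1 ≤ κ) (hρ : 0 ≤ ρ) (hρ1 : ρ < 1) :
    κ * ρ / (1 + (κ - 1) * ρ) / (1 - κ * ρ / (1 + (κ - 1) * ρ)) = κ * (ρ / (1 - ρ)) := by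
  have h1 : 0 < 1 + (κ - 1) * ρ := by nlinarith [mul_nonneg (sub_nonneg.2 hκ) hρ]
  have hg : κ * ρ / (1 + (κ - 1) * ρ) * (1 + (κ - 1) * ρ) = κ * ρ := div_mul_cancel₀ _ h1.ne'
  have hlt : κ * ρ / (1 + (κ - 1) * ρ) < 1 := by rw [div_lt_one h1]; nlinarith
  rw [← mul_div_assoc, div_eq_div_iff (sub_pos.2 hlt).ne' (sub_pos.2 hρ1).ne']
  linear_combination hg

/-- **SEMIGROUP.**  Two successive tilts with ranges `κ₁`, `κ₂` compose EXACTLY to one with range `κ₁κ₂`: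
`g(κ₂, g(κ₁, ρ)) = g(κ₁κ₂, ρ)` (`κᵢ ≥ 1`, `ρ ≥ 0`) — iterating `abs_tilted_real_sub_tilted_real_le_of_tv` along `f₁`, then `f₂` loses nothing against
tilting once by `f₁ + f₂` with `c = c₁ + c₂`. [folklore] -/
theorem sharpTiltRate_comp {κ₁ κ₂ ρ : ℝ} (hκ₁ : 1 ≤ κ₁) (hκ₂ : 1 ≤ κ₂) (hρ : 0 ≤ ρ) :
    κ₂ * (κ₁ * ρ / (1 + (κ₁ - 1) * ρ)) / (1 + (κ₂ - 1) * (κ₁ * ρ / (1 + (κ₁ - 1) * ρ))) =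
      κ₁ * κ₂ * ρ / (1 + (κ₁ * κ₂ - 1) * ρ) := by
  have h1 : 0 < 1 + (κ₁ - 1) * ρ := by nlinarith [mul_nonneg (sub_nonneg.2 hκ₁) hρ]
  have h12 : 0 < 1 + (κ₁ * κ₂ - 1) * ρ := by
    nlinarith [mul_nonneg (sub_nonneg.2 (one_le_mul_of_one_le_of_one_le hκ₁ hκ₂)) hρ]
  have hg0 : 0 ≤ κ₁ * ρ / (1 + (κ₁ - 1) * ρ) := div_nonneg (mul_nonneg (zero_le_one.trans hκ₁) hρ) h1.le
  have h2 : 0 < 1 + (κ₂ - 1) * (κ₁ * ρ / (1 + (κ₁ - 1) * ρ)) := by nlinarith [mul_nonneg (sub_nonneg.2 hκ₂) hg0]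
  have hg : κ₁ * ρ / (1 + (κ₁ - 1) * ρ) * (1 + (κ₁ - 1) * ρ) = κ₁ * ρ := div_mul_cancel₀ _ h1.ne'
  rw [div_eq_div_iff h2.ne' h12.ne']
  linear_combination κ₂ * hg

end Structure

end Summit.QuantumFields.YangMills.BalabanUVNodes.N19TVTiltSharpLeaf

end
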